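import Literature.NumberTheory.ComplexMultiplication.CMTypeRankOrbitPairing
import Literature.NumberTheory.ComplexMultiplication.CMFieldConjSquareQuadraticSubfields
import Literature.NumberTheory.ComplexMultiplication.QuarticCMTypes
import Literature.AlgebraicGeometry.Pohlmann1968.NondegenerateCMAlgebraTypes
import HarnessLib

/-!
# The closure bound: `rank(Φ_i)_i ≤ [L : ℚ]/2 + 1` for CM types whose embeddings land in a subfield `L ⊂ ℂ` of finite
# degree — products of CM abelian varieties with CM inside one Galois CM field, and the dihedral surface triple

COR-CM (cell `pub-hodgecm2`, seat p2 gen 18, count-neutral claim CLOSURE-BOUND); NEW as stated, hence under `Summits/`.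
Theorems only; no definition, no named fact, no `sorry`.

THE MATHEMATICS.  Let `(K_i, Φ_i)_{i∈I}` be CM types of CM fields and `A = ∏_i A_i` a product of realisations.  The
Mumford–Tate group of `A` is a quotient of the Serre group of any Galois CM field `L ⊂ ℂ` containing all the conjugates of
all the `K_i`, whose dimension is `[L : ℚ]/2 + 1` (Deligne, LNM 900, I Ex. 3.7 and the description of the Serre group;
Milne's "`rank Hg ≤ …`").  In the tree's combinatorial language (Deligne's (c): "`Y(G)` is the `Gal(ℚ̄/ℚ)`-module generated
by `μ`"): `cmFamilyRank Φ = dim span{𝟙_{τΣ} | τ ∈ Aut(ℂ)}`, the translate `τΣ` only depends on `τ|_L`, which takes at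
most `[L : ℚ]` values (NO normality of `L` is needed for this count), and the translates pair off as `{τΣ, ρτΣ}` with
constant sum (Shimura §32.10, the tree's `CMTypeRankOrbitPairing`).  Hence

  **`cmFamilyRank Φ ≤ [L : ℚ]/2 + 1`**   (`cmFamilyRank_le_finrank_div_two_add_one`)

for EVERY finite-dimensional subfield `L ⊂ ℂ` with `s(K_i) ⊆ L` for all `i` and all `s : K_i → ℂ`, and a NONDEGENERATE family
(`cmFamilyRank Φ = Σ_i [K_i:ℚ]/2 + 1`, Gordon's "`rank Hg(A)_ℂ = rdim A`") must have **`Σ_i [K_i : ℚ] ≤ [L : ℚ]`**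
(`sum_finrank_le_of_isNondegenerateFamily`), i.e. `2 Σ_i dim A_i ≤ [L : ℚ]`.  By Hazama–Murty (Gordon 7.5; the tree's
`CMAlgebra.exists_exceptional_prod_of_not_isNondegenerateFamily`) a separating family (simple, pairwise non-isogenous `A_i`)
violating this carries an exceptional Hodge class on some product `⨁_{j<N} A_{π j}`
(`exists_exceptional_prod_of_finrank_lt_sum`).

TWO INSTANCES (both need the SHARP `/2`):
* **Galois hub** (`not_isNondegenerateFamily_of_normal_hub`, `exists_exceptional_prod_of_normal_hub`): some `K_{i₀}` is
  GALOIS over `ℚ` and every `K_i` embeds into `K_{i₀}` (e.g. the other `K_i` are CM subfields of `K_{i₀}`, or equal to it).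
  With `L =` the image of `K_{i₀}`: `rank ≤ [K_{i₀}:ℚ]/2 + 1 < ([K_{i₀}:ℚ] + [K_{i₁}:ℚ])/2 + 1`, so for `|I| ≥ 2` NO family
  is nondegenerate.  Examples: `A` with CM by `ℚ(ζ₁₃)` times `B` with CM by the quartic CM subfield of `ℚ(ζ₁₃)`; `A` with
  CM by a Galois CM field `K` times a CM elliptic curve with CM by `k ⊂ K` (the case of
  `SharedImaginaryQuadraticDegenerate` / `SharedImaginaryQuadraticFamilies`, seat b23); two CM-inequivalent simple `A, A'`
  with CM by the same Galois `K` (`GaloisCMFieldExoticProducts.not_isNondegenerateFamily_of_two_le_card`, seat lit-deligne-3,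
  whose bound `rank ≤ [K:ℚ]` is the unpaired count).  New here: ARBITRARY CM subfields `K_i ↪ K_{i₀}`.
* **Dihedral surface triple** (`not_isNondegenerateFamily_of_quartic_of_mem_normalClosure`,
  `exists_exceptional_prod_surfaces_of_mem_normalClosure`): three (or more) quartic CM fields all of whose complex
  embeddings land in the Galois closure of ONE non-Galois quartic CM field `K_{i₀}` — an octic dihedral field
  (`QuarticCMTypes.finrank_normalClosure_eq_eight_of_not_isGalois`): `Σ_i [K_i:ℚ] ≥ 12 > 8`.  So three pairwise
  non-isogenous simple CM abelian surfaces `S₁, S₁′, S₂` with a common dihedral Galois closure always have a product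
  `S₁^a × S₁′^b × S₂^c` with an exceptional Hodge class — the CM-type form of the kernel census
  `Census/DihedralSurfaceTriple` (seat lit-andre-3: `B²(S₁ × S₁′ × S₂) = 19 = 15 + 4`), although every PAIR of them is a
  nondegenerate family (`QuarticCMTypePairNondegenerate`, seat b24, for `S₁, S₁′`; Moonen–Zarhin).  The unpaired count
  (`8 ≥ 7`) would decide nothing here.

## References

* [Deligne1982HodgeCycles] P. Deligne, *Hodge cycles on abelian varieties*, LNM 900 (1982), I Ex. 3.7 (c)–(d).
* [Shimura1998] G. Shimura, *Abelian Varieties with Complex Multiplication and Modular Functions*, §32.10; §8.4 (2)(C).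
* [Gordon1999HodgeAVSurvey] B. B. Gordon, *A survey of the Hodge conjecture for abelian varieties*, 7.5–7.7, 8.8.
* [MoonenZarhin1999LowDim] B. Moonen, Yu. Zarhin, Math. Ann. 315 (1999), "Hodge groups of simple abelian surfaces of
  CM-type".
-/

noncomputable section

open CategoryTheory CategoryTheory.Limits NumberField NumberField.ComplexEmbedding IntermediateField
open scoped BigOperators

namespace Summit.HodgeConjecture.CorCM

open Literature.NumberTheory.ComplexMultiplication
open Literature.AlgebraicGeometry.Motives (AbelianVariety CMType)
open Literature.AlgebraicGeometry.HodgeTheory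
open Literature.AlgebraicGeometry.ComplexMultiplication (IsCMTypeRealisation)
open Literature.AlgebraicGeometry.VanGeemen1994 (hodgeClassSpan)
open Literature.AlgebraicGeometry.Pohlmann1968
open Literature.Barriers.HodgeConjecture (divisorClassesSpan)

section Rank

variable {I : Type} {K : I → Type} [∀ i, Field (K i)] [∀ i, NumberField (K i)] [∀ i, IsCMField (K i)] [Fintype I]

omit [∀ i, IsCMField (K i)] in
/-- `|⊔_i Hom(K_i, ℂ)| = Σ_i [K_i : ℚ]`. [folklore] -/
private theorem card_sigma_ringHom_eq_sum :
    Fintype.card ((i : I) × (K i →+* ℂ)) = ∑ i, Module.finrank ℚ (K i) := by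
  rw [Fintype.card_sigma]
  exact Finset.sum_congr rfl fun i _ => Embeddings.card (K i) ℂ

/-- `Σ_i [K_i : ℚ]` is even (each `K_i` is a CM field: `Σ ⊔ ρΣ = ⊔_i Hom(K_i, ℂ)`). [folklore] -/
private theorem two_dvd_sum_finrank (Φ : ∀ i, CMType (K i)) : 2 ∣ ∑ i, Module.finrank ℚ (K i) := by
  rw [← card_sigma_ringHom_eq_sum (K := K)]
  exact (CMAlgebra.isCMTypeWith_familyType Φ).two_dvd_card

/-- **The closure bound.**  If every complex embedding of every `K_i` takes values in a subfield `L ⊂ ℂ` of finite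
degree over `ℚ` (no normality required), then `cmFamilyRank Φ ≤ [L : ℚ]/2 + 1`: the translate `τ • Σ` of Deligne's
`Σ ⊆ ⊔_i Hom(K_i, ℂ)` only depends on the restriction `τ|_L : L → ℂ`, of which there are `[L : ℚ]`, and the translates
pair off (`CMTypeRankOrbitPairing`).  On Mumford–Tate groups: `dim MT(∏_i A_i) ≤ [L : ℚ]/2 + 1`, the dimension of the
Serre group of (the Galois closure of) `L`. [cite: Deligne1982HodgeCycles, I Ex. 3.7 (c)–(d) (p. 26)]
[cite: Shimura1998, §32.10] -/
theorem cmFamilyRank_le_finrank_div_two_add_one [Nonempty I] (Φ : ∀ i, CMType (K i)) (L : IntermediateField ℚ ℂ)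
    [FiniteDimensional ℚ L] (hL : ∀ (i : I) (s : K i →+* ℂ) (y : K i), s y ∈ L) :
    CMAlgebra.cmFamilyRank Φ ≤ Module.finrank ℚ L / 2 + 1 := by
  haveI : NumberField L := { to_charZero := inferInstance, to_finiteDimensional := inferInstance }
  obtain ⟨i₀⟩ := ‹Nonempty I›
  obtain ⟨s₀⟩ : Nonempty (K i₀ →+* ℂ) := inferInstance
  haveI : Nonempty ((i : I) × (K i →+* ℂ)) := ⟨⟨i₀, s₀⟩⟩
  have hcard : Nat.card (L →+* ℂ) = Module.finrank ℚ L := by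
    rw [Nat.card_eq_fintype_card]
    exact Embeddings.card L ℂ
  rw [← hcard]
  refine typeRank_sigmaType_le_natCard_div_two_add_one_of_factors (Φ := fun i => (Φ i).1)
    (fun i => isCMTypeWith_conj (Φ i)) (fun τ : ℂ ≃+* ℂ => (τ : ℂ →+* ℂ).comp (algebraMap L ℂ)) ?_
  intro τ τ' hττ' i s
  refine RingHom.ext fun y => ?_
  have := RingHom.congr_fun hττ' ⟨s y, hL i s y⟩
  exact this

/-- **A nondegenerate family has `Σ_i [K_i : ℚ] ≤ [L : ℚ]`** for every subfield `L ⊂ ℂ` of finite degree containing all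
the `s(K_i)`: `Σ_i [K_i:ℚ]/2 + 1 = rank ≤ [L:ℚ]/2 + 1` and `Σ_i [K_i:ℚ]` is even — on abelian varieties, a stably
nondegenerate product `∏_i A_i` of CM abelian varieties has `2 Σ_i dim A_i ≤ [L : ℚ]` ("`rank Hg(A) ≤ rdim A`" with
equality, and `rank Hg(A) + 1 ≤ dim` of the Serre group). [cite: Gordon1999HodgeAVSurvey, 7.5–7.7]
[cite: Deligne1982HodgeCycles, I Ex. 3.7 (c)–(d) (p. 26)] -/
theorem sum_finrank_le_of_isNondegenerateFamily [Nonempty I] {Φ : ∀ i, CMType (K i)} (L : IntermediateField ℚ ℂ)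
    [FiniteDimensional ℚ L] (hL : ∀ (i : I) (s : K i →+* ℂ) (y : K i), s y ∈ L)
    (hΦ : CMAlgebra.IsNondegenerateFamily Φ) : ∑ i, Module.finrank ℚ (K i) ≤ Module.finrank ℚ L := by
  rw [CMAlgebra.isNondegenerateFamily_iff] at hΦ
  have h1 := cmFamilyRank_le_finrank_div_two_add_one Φ L hL
  obtain ⟨a, ha⟩ := two_dvd_sum_finrank Φ
  rw [hΦ, ha] at h1
  omega

/-- **Degeneracy from the closure bound**: if `[L : ℚ] < Σ_i [K_i : ℚ]` for some subfield `L ⊂ ℂ` of finite degree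
containing every `s(K_i)`, the family `(Φ_i)_i` is NOT nondegenerate, whatever the types. [cite: Gordon1999HodgeAVSurvey, 7.5–7.7] -/
theorem not_isNondegenerateFamily_of_finrank_lt_sum [Nonempty I] (Φ : ∀ i, CMType (K i)) (L : IntermediateField ℚ ℂ)
    [FiniteDimensional ℚ L] (hL : ∀ (i : I) (s : K i →+* ℂ) (y : K i), s y ∈ L)
    (hlt : Module.finrank ℚ L < ∑ i, Module.finrank ℚ (K i)) : ¬CMAlgebra.IsNondegenerateFamily Φ := fun hΦ =>
  absurd (sum_finrank_le_of_isNondegenerateFamily L hL hΦ) (not_le.2 hlt)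

/-! ### The Galois hub: every `K_i` embeds into one Galois `K_{i₀}` -/

omit [∀ i, IsCMField (K i)] [Fintype I] in
/-- Every complex embedding of `K_i` extends along `e : K_i → K_{i₀}` to a complex embedding of `K_{i₀}` (`K_{i₀}/e(K_i)`
algebraic, `ℂ` algebraically closed). [folklore] -/
private theorem exists_comp_eq_of_ringHom {i i₀ : I} (e : K i →+* K i₀) (t : K i →+* ℂ) :
    ∃ s : K i₀ →+* ℂ, s.comp e = t := by
  letI : Algebra (K i) (K i₀) := e.toAlgebra
  letI : Algebra (K i) ℂ := t.toAlgebra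
  haveI : IsScalarTower ℚ (K i) (K i₀) := IsScalarTower.of_algebraMap_eq fun x => (map_ratCast e x).symm
  haveI : Algebra.IsAlgebraic (K i) (K i₀) := Algebra.IsAlgebraic.tower_top (K := ℚ) (K i)
  let ψ : K i₀ →ₐ[K i] ℂ := IsAlgClosed.lift
  exact ⟨ψ.toRingHom, ψ.comp_algebraMap⟩

omit [∀ i, IsCMField (K i)] [Fintype I] in
/-- If `K_{i₀}` is normal over `ℚ` and `K_i` embeds into it, every complex embedding of `K_i` lands in the Galois closure
`normalClosure ℚ K_{i₀} ℂ` (= the common image of all embeddings of `K_{i₀}`). [cite: Shimura1998, §8.1] -/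
theorem apply_mem_normalClosure_of_ringHom {i i₀ : I} (e : K i →+* K i₀) (t : K i →+* ℂ) (y : K i) :
    t y ∈ normalClosure ℚ (K i₀) ℂ := by
  obtain ⟨s, rfl⟩ := exists_comp_eq_of_ringHom e t
  exact apply_mem_normalClosure (K := K) i₀ s (e y)

/-- **Galois hub, rank form**: if `K_{i₀}` is Galois over `ℚ` and every `K_i` embeds into `K_{i₀}`, then
`cmFamilyRank Φ ≤ [K_{i₀} : ℚ]/2 + 1` — the rank of the Serre group of `K_{i₀}`. [cite: Deligne1982HodgeCycles, I Ex. 3.7 (c)–(d) (p. 26)] -/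
theorem cmFamilyRank_le_of_normal_hub [Nonempty I] (Φ : ∀ i, CMType (K i)) (i₀ : I) [Normal ℚ (K i₀)]
    (e : ∀ i, K i →+* K i₀) : CMAlgebra.cmFamilyRank Φ ≤ Module.finrank ℚ (K i₀) / 2 + 1 := by
  rw [← finrank_normalClosure_of_normal (K := K i₀)]
  exact cmFamilyRank_le_finrank_div_two_add_one Φ (normalClosure ℚ (K i₀) ℂ)
    fun i t y => apply_mem_normalClosure_of_ringHom (e i) t y

/-- **Galois hub: no family with two or more members is nondegenerate** when some `K_{i₀}` is Galois over `ℚ` and every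
`K_i` embeds into `K_{i₀}` (`Σ_i [K_i:ℚ] ≥ [K_{i₀}:ℚ] + [K_{i₁}:ℚ] > [K_{i₀}:ℚ]`).  Contains: two CM-inequivalent types of
one Galois field (`GaloisCMFieldExoticProducts`), a Galois CM field and an imaginary quadratic subfield
(`SharedImaginaryQuadraticDegenerate`); new: a Galois CM field and ANY of its proper CM subfields (e.g. `ℚ(ζ₁₃)` and its
quartic CM subfield), with arbitrary types. [cite: Gordon1999HodgeAVSurvey, 7.5–7.7 and 8.8] -/
theorem not_isNondegenerateFamily_of_normal_hub (Φ : ∀ i, CMType (K i)) (i₀ : I) [Normal ℚ (K i₀)]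
    (e : ∀ i, K i →+* K i₀) (hI : 2 ≤ Fintype.card I) : ¬CMAlgebra.IsNondegenerateFamily Φ := by
  classical
  haveI : Nonempty I := ⟨i₀⟩
  -- a second index
  obtain ⟨i₁, hi₁⟩ : ∃ i₁ : I, i₁ ≠ i₀ := by
    by_contra h
    push Not at h
    have : Fintype.card I ≤ 1 := Fintype.card_le_one_iff.2 fun a b => by rw [h a, h b]
    omega
  refine not_isNondegenerateFamily_of_finrank_lt_sum Φ (normalClosure ℚ (K i₀) ℂ)
    (fun i t y => apply_mem_normalClosure_of_ringHom (e i) t y) ?_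
  rw [finrank_normalClosure_of_normal (K := K i₀)]
  have hpos : 0 < Module.finrank ℚ (K i₁) := Module.finrank_pos
  have hsub : ({i₀, i₁} : Finset I) ⊆ Finset.univ := Finset.subset_univ _
  have hle := Finset.sum_le_sum_of_subset_of_nonneg hsub (f := fun i => Module.finrank ℚ (K i))
    (fun i _ _ => Nat.zero_le _)
  rw [Finset.sum_pair hi₁.symm] at hle
  omega

end Rank

/-! ### The dihedral surface triple: three quartic CM fields in one octic Galois closure -/

section Quartic

variable {I : Type} {K : I → Type} [∀ i, Field (K i)] [∀ i, NumberField (K i)] [∀ i, IsCMField (K i)] [Fintype I]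

omit [Fintype I] in
/-- The Galois closure in `ℂ` of a non-Galois quartic CM field has degree `8` (Shimura's Example (2)(C), the tree's
`finrank_normalClosure_eq_eight_of_not_isGalois`, read for `normalClosure ℚ K ℂ`). [cite: Shimura1998, §8.4 Example (2)(C)] -/
theorem finrank_normalClosure_complex_eq_eight (i₀ : I) (h4 : Module.finrank ℚ (K i₀) = 4)
    (hK : ¬IsGalois ℚ (K i₀)) : Module.finrank ℚ ↥(normalClosure ℚ (K i₀) ℂ) = 8 := by
  haveI : IsNormalClosure ℚ (K i₀) ↥(normalClosure ℚ (K i₀) ℂ) :=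
    Algebra.IsAlgebraic.isNormalClosure_normalClosure fun x => IsAlgClosed.splits _
  haveI : NumberField ↥(normalClosure ℚ (K i₀) ℂ) :=
    { to_charZero := inferInstance, to_finiteDimensional := inferInstance }
  exact finrank_normalClosure_eq_eight_of_not_isGalois (K := K i₀) (L := ↥(normalClosure ℚ (K i₀) ℂ)) h4 hK

/-- **The dihedral surface triple is degenerate.**  Let `K_{i₀}` be a NON-GALOIS quartic CM field and `(K_i)_{i∈I}`,
`|I| ≥ 3`, quartic fields all of whose complex embeddings land in the (octic, dihedral) Galois closure of `K_{i₀}` in `ℂ`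
— e.g. `K_{i₀}` taken twice and the other quartic CM class `M` of the same closure (Shimura's `K` and `K* = ℚ(ξ + ξ^φ)`).
Then NO family of CM types `(Φ_i)_i` is nondegenerate: `Σ_i [K_i:ℚ] ≥ 12 > 8`.  (For `|I| = 2` the bound `8/2 + 1 = 5` is
attained: such pairs ARE nondegenerate, `QuarticCMTypePairNondegenerate`.) [cite: MoonenZarhin1999LowDim, "Hodge groups of simple abelian surfaces of CM-type"]
[cite: Shimura1998, §8.4 Example (2)(C)] -/
theorem not_isNondegenerateFamily_of_quartic_of_mem_normalClosure (Φ : ∀ i, CMType (K i)) (i₀ : I)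
    (h4 : Module.finrank ℚ (K i₀) = 4) (hK : ¬IsGalois ℚ (K i₀)) (hdeg : ∀ i, 4 ≤ Module.finrank ℚ (K i))
    (hL : ∀ (i : I) (s : K i →+* ℂ) (y : K i), s y ∈ normalClosure ℚ (K i₀) ℂ) (hI : 3 ≤ Fintype.card I) :
    ¬CMAlgebra.IsNondegenerateFamily Φ := by
  haveI : Nonempty I := ⟨i₀⟩
  refine not_isNondegenerateFamily_of_finrank_lt_sum Φ (normalClosure ℚ (K i₀) ℂ) hL ?_
  rw [finrank_normalClosure_complex_eq_eight i₀ h4 hK]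
  have hle : ∑ _i : I, 4 ≤ ∑ i, Module.finrank ℚ (K i) := Finset.sum_le_sum fun i _ => hdeg i
  rw [Finset.sum_const, Finset.card_univ, smul_eq_mul] at hle
  omega

end Quartic

/-! ### Geometry: exceptional Hodge classes on the products -/

section Geometry

variable {I : Type} {K : I → Type} [∀ i, Field (K i)] [∀ i, NumberField (K i)] [∀ i, IsCMField (K i)] [Fintype I]
  [Nonempty I] {Φ : ∀ i, CMType (K i)}
variable {A : I → AbelianVariety ℂ} {ι : ∀ i, 𝓞 (K i) →+* End (A i)}
  {θ : ∀ i, K i →+* Module.End ℂ (complexBetti (A i).X 1)}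

/-- **Exceptional Hodge classes from the closure bound.**  Let `(A_i, ι_i, θ_i)` realise a SEPARATING family
`(K_i, Φ_i)_{i∈I}` (the `A_i` simple and pairwise non-isogenous) and let `L ⊂ ℂ` be a subfield of finite degree containing
every `s(K_i)` with `[L : ℚ] < Σ_i [K_i : ℚ] = 2 Σ_i dim A_i`.  Then some product `⨁_{j<N} A_{π j}` carries a rational
`(m,m)` class OUTSIDE `Dᵐ ⊗ ℂ` (Hazama–Murty: `rank Hg(A) < rdim A` ⟹ an exotic Hodge class on some power).
[cite: Gordon1999HodgeAVSurvey, 7.5 and 8.8] [cite: Deligne1982HodgeCycles, I Ex. 3.7 (c)–(d) (p. 26)] -/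
theorem exists_exceptional_prod_of_finrank_lt_sum (hsep : CMAlgebra.IsSeparatingFamily Φ) (L : IntermediateField ℚ ℂ)
    [FiniteDimensional ℚ L] (hL : ∀ (i : I) (s : K i →+* ℂ) (y : K i), s y ∈ L)
    (hlt : Module.finrank ℚ L < ∑ i, Module.finrank ℚ (K i)) (hA : ∀ i, IsCMTypeRealisation (Φ i) (A i) (ι i) (θ i)) :
    ∃ (N : ℕ) (π : Fin N → I) (m : ℕ) (c : complexBetti (⨁ fun j : Fin N => A (π j)).X (2 * m)),
      IsRationalClass c ∧
      IsOfHodgeType (⨁ fun j : Fin N => A (π j)).dim (⨁ fun j : Fin N => A (π j)).X (2 * m) m m c ∧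
      c ∉ divisorClassesSpan (⨁ fun j : Fin N => A (π j)).X (⨁ fun j : Fin N => A (π j)).dim m :=
  CMAlgebra.exists_exceptional_prod_of_not_isNondegenerateFamily hsep
    (not_isNondegenerateFamily_of_finrank_lt_sum Φ L hL hlt) hA

/-- The same in the `B• = D•` form: NOT every product `⨁_{j<N} A_{π j}` has `Bᵐ ⊗ ℂ = Dᵐ ⊗ ℂ`.
[cite: Gordon1999HodgeAVSurvey, 7.5 and 8.8] -/
theorem not_forall_prod_hodgeClassSpan_eq_of_finrank_lt_sum (hsep : CMAlgebra.IsSeparatingFamily Φ)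
    (L : IntermediateField ℚ ℂ) [FiniteDimensional ℚ L] (hL : ∀ (i : I) (s : K i →+* ℂ) (y : K i), s y ∈ L)
    (hlt : Module.finrank ℚ L < ∑ i, Module.finrank ℚ (K i)) (hA : ∀ i, IsCMTypeRealisation (Φ i) (A i) (ι i) (θ i)) :
    ¬∀ (N : ℕ) (π : Fin N → I) (m : ℕ),
      hodgeClassSpan (⨁ fun j : Fin N => A (π j)).dim (⨁ fun j : Fin N => A (π j)).X m =
        divisorClassesSpan (⨁ fun j : Fin N => A (π j)).X (⨁ fun j : Fin N => A (π j)).dim m := fun h =>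
  not_isNondegenerateFamily_of_finrank_lt_sum Φ L hL hlt
    ((CMAlgebra.isNondegenerateFamily_iff_forall_prod_hodgeClassSpan_eq hsep hA).2 h)

/-- **Exceptional Hodge classes on products of CM abelian varieties with CM inside one Galois CM field.**  Let `K_{i₀}`
be a Galois CM field, every `K_i` embed into `K_{i₀}` (`|I| ≥ 2`), and `(A_i, ι_i, θ_i)` realise a SEPARATING family
`(Φ_i)_i` — e.g. `A` simple with CM by a Galois `K` and `A'` simple with CM by a proper CM subfield `K' ⊂ K` (`A'` is not
isogenous to `A`: different dimensions).  Then some `⨁_{j<N} A_{π j}` — some `A^a × A'^b` — carries an exceptional Hodge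
class. [cite: Gordon1999HodgeAVSurvey, 7.5 and 8.8] [cite: Deligne1982HodgeCycles, I Ex. 3.7 (c)–(d) (p. 26)] -/
theorem exists_exceptional_prod_of_normal_hub (hsep : CMAlgebra.IsSeparatingFamily Φ) (i₀ : I) [Normal ℚ (K i₀)]
    (e : ∀ i, K i →+* K i₀) (hI : 2 ≤ Fintype.card I) (hA : ∀ i, IsCMTypeRealisation (Φ i) (A i) (ι i) (θ i)) :
    ∃ (N : ℕ) (π : Fin N → I) (m : ℕ) (c : complexBetti (⨁ fun j : Fin N => A (π j)).X (2 * m)),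
      IsRationalClass c ∧
      IsOfHodgeType (⨁ fun j : Fin N => A (π j)).dim (⨁ fun j : Fin N => A (π j)).X (2 * m) m m c ∧
      c ∉ divisorClassesSpan (⨁ fun j : Fin N => A (π j)).X (⨁ fun j : Fin N => A (π j)).dim m :=
  CMAlgebra.exists_exceptional_prod_of_not_isNondegenerateFamily hsep
    (not_isNondegenerateFamily_of_normal_hub Φ i₀ e hI) hA

/-- **Exceptional Hodge classes on the dihedral surface triple.**  Let `K_{i₀}` be a non-Galois quartic CM field and
`(K_i)_{i∈I}`, `|I| ≥ 3`, quartic CM fields whose complex embeddings all land in the Galois closure of `K_{i₀}` in `ℂ`; let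
`(S_i, ι_i, θ_i)` realise a SEPARATING family of CM types `(Φ_i)_i` — three or more pairwise non-isogenous simple CM
abelian surfaces with a common dihedral Galois closure (two isogeny classes for `K_{i₀}` itself, two for the other quartic
CM class of the closure).  Then some product `⨁_{j<N} S_{π j}` carries an exceptional Hodge class: the structural form of
the census `Census/DihedralSurfaceTriple` (`B²(S₁ × S₁′ × S₂) = 15 + 4`). [cite: MoonenZarhin1999LowDim, "Hodge groups of simple abelian surfaces of CM-type"]
[cite: Gordon1999HodgeAVSurvey, 7.5 and 8.8] -/
theorem exists_exceptional_prod_surfaces_of_mem_normalClosure (hsep : CMAlgebra.IsSeparatingFamily Φ) (i₀ : I)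
    (h4 : Module.finrank ℚ (K i₀) = 4) (hK : ¬IsGalois ℚ (K i₀)) (hdeg : ∀ i, 4 ≤ Module.finrank ℚ (K i))
    (hL : ∀ (i : I) (s : K i →+* ℂ) (y : K i), s y ∈ normalClosure ℚ (K i₀) ℂ) (hI : 3 ≤ Fintype.card I)
    (hA : ∀ i, IsCMTypeRealisation (Φ i) (A i) (ι i) (θ i)) :
    ∃ (N : ℕ) (π : Fin N → I) (m : ℕ) (c : complexBetti (⨁ fun j : Fin N => A (π j)).X (2 * m)),
      IsRationalClass c ∧
      IsOfHodgeType (⨁ fun j : Fin N => A (π j)).dim (⨁ fun j : Fin N => A (π j)).X (2 * m) m m c ∧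
      c ∉ divisorClassesSpan (⨁ fun j : Fin N => A (π j)).X (⨁ fun j : Fin N => A (π j)).dim m :=
  CMAlgebra.exists_exceptional_prod_of_not_isNondegenerateFamily hsep
    (not_isNondegenerateFamily_of_quartic_of_mem_normalClosure Φ i₀ h4 hK hdeg hL hI) hA

end Geometry

end Summit.HodgeConjecture.CorCM

end
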